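import Summits.BirchSwinnertonDyer.BirchSwinnertonDyer.Theorems.CMKolyvaginAtInertTwoTranspositionAtTwo
import HarnessLib

/-!
# Route `CMKolyvaginAtInertTwo`, crux `CMKolyvaginExactAtInertTwo` (stmt-BirchSwinnertonDyer-24277):
# GROSS'S PROP. 9.3 AT `p = 2` — the evaluations `ρ ↦ [x_i, ρ]` at independent classes
# `x_i ∈ H¹(K, E[2])` are JOINTLY SURJECTIVE onto `E[2]^r` (McCallum (2): `Gal(L_C/L) ≃ Hom(C, E_2)`)

Seat `bsd-line-cmk2-p1` g3 (cell `bsd-print-cf2`); helper (`--supports stmt-BirchSwinnertonDyer-24277`;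
also gk2's 22137). THEOREMS ONLY: no definition, no named fact, no `sorry`; no item is closed; BSD is
not proved by any of this.

WHY. The Čebotarev leaf of the tree's Kolyvagin machine (`exists_kolyvaginPrime_gt`, McCallum
Prop. 3.1 / Cor. 3.2) manufactures Kolyvagin primes with PRESCRIBED localisations of given classes
from two inputs: (i) Gross's Prop. 9.3 `exists_h1Eval_eq` — for classes `x₁, …, x_r ∈ H¹(K, E[p])`
independent mod `p` and ANY targets `e_i ∈ E[p]` there is `ρ ∈ Γ_{K(E[p])}` with `[x_i, ρ] = e_i`
— and (ii) the `τ`-eigenvector bookkeeping. The tree proves (i) from `E[p]` simple + scalar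
commutant (`KolyvaginPairing.eq_top_of_stable_of_indep`, any prime `p`) + Prop. 9.1, the LAST via
the homothety `−1` and `2 ∈ (ℤ/p)ˣ` (`hz`, `hu`) — void at `p = 2`. With the `p = 2` toolkit now in
the tree (Prop. 9.1 `h1_restriction_injective_two`, p595478; simplicity and commutant `𝔽₂`,
p595851; a transposition in `ρ̄(Γ_K)`, p596346) input (i) holds at `p = 2` VERBATIM:

* `exists_h1Eval_eq_two` — for `W/ℚ` with `ρ̄_{W,2}` onto, `[K : ℚ] = 2` and `Δ_E ∉ K²`
  (`¬ IsSquare (W⁄K).Δ`): classes `x_i ∈ H¹(K, E[2])` independent mod `2`, any targets `e_i`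
  ⟹ `∃ ρ ∈ Γ_{K(E[2])}, ∀ i, [x_i, ρ] = e_i`;
* `exists_h1Eval_eq_two_of_cmInert_two_of_heegner` — the same on the habitat H₂ (CM, `CMInert W 2`,
  `ρ̄₂` onto) for every imaginary quadratic `K` with the Heegner hypothesis, hypothesis-free.

What remains NOT portable is input (ii) (memo `Cruxes/CMExactDescentAtTwo/MEMO-tau-line-at-two.md`
§1: on `τ`-invariant classes the local pairing at a Kolyvagin prime vanishes identically); for
classes NOT fixed by `τ` the odd-`p` script runs with (i) (memo §2, «single primes kill
`(1+τ)·Sel₂(E/K)`»).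

References: [GrossLMS1991] §9 Props. 9.1, 9.3; [McCallumLMS1991] §3 (2), Prop. 3.1;
[LawsonWuthrich2016] Lemma 6.
-/

-- single-conjunct summit: `Summit.BirchSwinnertonDyer.BirchSwinnertonDyer.…` repeats the name by design
set_option linter.dupNamespace false
set_option autoImplicit false

noncomputable section

open scoped Classical

namespace Summit.BirchSwinnertonDyer.BirchSwinnertonDyer.Theorems.KolyvaginImageTwo

open WeierstrassCurve Field
open Literature.NumberTheory.EllipticCurves Literature.NumberTheory.GaloisRepresentations

/-- **Gross's Prop. 9.3 at `p = 2` (joint surjectivity of the evaluations).** For `W/ℚ` elliptic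
with `ρ̄_{W,2}` onto, `K` a number field with `[K : ℚ] = 2` in which `Δ(W)` is not a square, classes
`x₁, …, x_r ∈ H¹(K, E[2])` independent mod `2` (`∑ a_i x_i = 0 ⟹ 2 ∣ a_i`) and any
`e₁, …, e_r ∈ E(K̄)[2]`: some `ρ ∈ Γ_{K(E[2])}` has `[x_i, ρ] = e_i` for all `i`. Proof: the tree's
`KolyvaginPairing.eq_top_of_stable_of_indep` (any prime) for the `Γ_K`-stable subgroup `jointRange`,
fed with `E[2]` simple (`eq_bot_or_eq_top_two_of_hasSurjectiveModNGaloisRep`), scalar commutant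
(`eq_zero_or_eq_id_of_commute_two_of_hasSurjectiveModNGaloisRep` + a transposition from
`exists_transposition_of_not_isSquare_Δ`), and Prop. 9.1 at `2` (`h1_restriction_injective_two`) for
the independence of the coordinate functionals. [cite: GrossLMS1991, Prop. 9.3]
[cite: McCallumLMS1991, §3 (2)] -/
theorem exists_h1Eval_eq_two (W : WeierstrassCurve ℚ) [W.IsElliptic] (K : Type) [Field K]
    [NumberField K] (hK2 : Module.finrank ℚ K = 2) (hsurj : W.HasSurjectiveModNGaloisRep 2)
    (hΔK : ¬ IsSquare (W.baseChange K).Δ) {r : ℕ}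
    (xs : Fin r → galH1Torsion (W.baseChange K) ((2 : ℕ) : ℤ))
    (hind : ∀ a : Fin r → ℤ, ∑ i, a i • xs i = 0 → ∀ i, (((2 : ℕ) : ℕ) : ℤ) ∣ a i)
    (e : Fin r → geomTorsion (W.baseChange K) ((2 : ℕ) : ℤ)) :
    ∃ ρ ∈ torsionFixing (W.baseChange K) ((2 : ℕ) : ℤ),
      ∀ i, h1Eval (W.baseChange K) ((2 : ℕ) : ℤ) (xs i) ρ = e i := by
  haveI : (W.baseChange K).IsElliptic := by rw [baseChange]; infer_instance
  -- simplicity and scalar commutant of the `Γ_K`-module `E(K̄)[2]`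
  have hS := eq_bot_or_eq_top_two_of_hasSurjectiveModNGaloisRep W K hK2 hsurj
  obtain ⟨τ, u, w, hu0, hu, hw⟩ := exists_transposition_of_not_isSquare_Δ (W.baseChange K) hΔK
  have hC : ∀ f : geomTorsion (W.baseChange K) ((2 : ℕ) : ℤ) →+ geomTorsion (W.baseChange K) ((2 : ℕ) : ℤ),
      (∀ (g : absoluteGaloisGroup K) (t : geomTorsion (W.baseChange K) ((2 : ℕ) : ℤ)),
        f (g • t) = g • f t) → ∃ k : ℤ, ∀ t, f t = k • t := by
    intro f hf
    rcases eq_zero_or_eq_id_of_commute_two_of_hasSurjectiveModNGaloisRep W K hK2 hsurj hu hu0 hw f hf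
      with h | h
    · exact ⟨0, fun t ↦ by rw [h t, zero_smul]⟩
    · exact ⟨1, fun t ↦ by rw [h t, one_smul]⟩
  have htop := KolyvaginPairing.eq_top_of_stable_of_indep Nat.prime_two hS hC r
    (jointRange (W.baseChange K) xs) (fun g m hm ↦ smul_mem_jointRange (W.baseChange K) xs g hm)
    (fun a ha i ↦ ?_)
  · have : e ∈ jointRange (W.baseChange K) xs := by rw [htop]; trivial
    exact this
  · refine hind a (h1_restriction_injective_two W K hK2 hsurj fun ρ hρ ↦ ?_) i
    rw [h1Eval_sum (W.baseChange K) _ _ _ hρ]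
    simp only [h1Eval_zsmul (W.baseChange K) _ _ _ hρ]
    exact ha _ ⟨ρ, hρ, fun i ↦ rfl⟩

/-- **Gross's Prop. 9.3 at `p = 2` on the habitat H₂, hypothesis-free**: for `W/ℚ` globally minimal
with CM, `CMInert W 2`, `ρ̄_{W,2}` onto, and every imaginary quadratic `K` satisfying the Heegner
hypothesis for `N_E` (so `Δ_E ∉ K²`, `not_isSquare_algebraMap_Δ_of_cmInert_two_of_heegner`):
independent classes in `H¹(K, E[2])` have jointly surjective evaluations on `Γ_{K(E[2])}`.
[cite: GrossLMS1991, Prop. 9.3] [cite: McCallumLMS1991, §3 (2)] -/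
theorem exists_h1Eval_eq_two_of_cmInert_two_of_heegner (W : WeierstrassCurve ℚ) [W.IsElliptic]
    [W.IsGloballyMinimal] (hCM : W.HasCM)
    (hin : Literature.NumberTheory.EllipticCurves.Rank1Residual.CMInert W 2)
    (hsurj : W.HasSurjectiveModNGaloisRep 2) (K : Type) [Field K] [NumberField K]
    (hK : IsImaginaryQuadratic K) (hH : SatisfiesHeegnerHypothesis (W.conductorNorm ℤ) K) {r : ℕ}
    (xs : Fin r → galH1Torsion (W.baseChange K) ((2 : ℕ) : ℤ))
    (hind : ∀ a : Fin r → ℤ, ∑ i, a i • xs i = 0 → ∀ i, (((2 : ℕ) : ℕ) : ℤ) ∣ a i)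
    (e : Fin r → geomTorsion (W.baseChange K) ((2 : ℕ) : ℤ)) :
    ∃ ρ ∈ torsionFixing (W.baseChange K) ((2 : ℕ) : ℤ),
      ∀ i, h1Eval (W.baseChange K) ((2 : ℕ) : ℤ) (xs i) ρ = e i := by
  have hΔK : ¬ IsSquare (W.baseChange K).Δ := by
    have : (W.baseChange K).Δ = algebraMap ℚ K W.Δ := by rw [baseChange, map_Δ]
    rw [this]
    exact not_isSquare_algebraMap_Δ_of_cmInert_two_of_heegner W hCM hin hsurj K hK hH
  exact exists_h1Eval_eq_two W K hK.1 hsurj hΔK xs hind e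

end Summit.BirchSwinnertonDyer.BirchSwinnertonDyer.Theorems.KolyvaginImageTwo

end
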